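import Summits.Parity.GeneralizedHardyLittlewood.Theorems.GoldbachHeathBrownDispersionHeathBrownMorozUniformSigmaOneCoprimeCoeffs
import HarnessLib

/-!
# The coprime-restricted singular sum `Σ₁^{(d)}`, II: Perron's formula, the residue, and the theorem (stub S3 `stub_sigmaOneCoprime`, line `parent-differencing`, crux `HeathBrownMorozUniform`, stmt-Parity-19915)

Helper file (`--supports stmt-Parity-19915`) for the crux
`Summit.Parity.GeneralizedHardyLittlewood.Theses.GoldbachHeathBrownDispersion.HeathBrownMorozUniform`
(Heath-Brown–Moroz 2004, Theorem 2 for `x³ + 2y³`).  **Nothing here bears on Goldbach**: this is one arithmetic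
input of ONE line of attack on ONE crux of a FRONTIER formalisation rung (a 2004 theorem).

Main result `classSigmaOneCoprime` — literally the registered stub signature `ClassSigmaOneCoprime` of
`Cruxes/HeathBrownMorozUniform/Lines/parent_differencing.lean`: for `d ≥ 1` and `σ₀` the limit of the ordered
partial products `singularProductPartial` of Heath-Brown's singular series there are `c, C > 0` with, for all `x ≥ 1`,

  `|∑_{N(J) ≤ x, N(J) □-free, (d, N(J)) = 1} μ(J) log(x/N(J)) ρ₂(J)/N(J) − (π²/6)σ₀·coprimeClassWeight d| ≤ C e^{−c√(log x)}`,

`coprimeClassWeight d = ∏_{p ∣ d}(p+1)/(p+1−ν_p)` — the sum `Σ₆` of [HeathBrownMoroz2004] p. 20 ("as in [3, p. 62]"),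
i.e. Heath-Brown's `Σ₁` ([HeathBrownActa2001] §10 pp. 62–63; tree `CubicSieve.HeathBrown2001_sigmaOne_bound`, `d = 1`)
with the extra condition `(N(J), d) = 1`.

## Proof (continuing `…SigmaOneCoprimeCoeffs`: `a` with `ha : ∀ n, a n = [(d,n)=1]·a(n)`, `h_d = a * normCountAF`,
`F_d(n) = |h_d(n)| n^{-3/4}`; no definitions are declared)

* §D `∑_n |h_d(n)| n^{-3/4} ≤ M_d = (1 + T₀)^{ω(d)} B_h` (finite Euler products, `CubicSieve.summable_of_prod_tsum_le`);
* §E `L(a_d, s)ζ_K(s) = L(h_d, s)` (`Re s > 1`) and the tree's Perron-formula theorem with the classical zero-free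
  region `LFunctions.NumberField.logRieszMean_LSeries_div_dedekindZeta_bound` (`σ_h = 3/4`):
  `|∑_{n≤x} a_d(n)n⁻¹log(x/n) − L(h_d,1)/γ₀| ≤ C e^{−c√log x}`;
* §F the residue `L(h_d, 1) = ∑_n h_d(n)/n = (σ₀γ₀π²/6)·coprimeClassWeight d` (Mathlib's `EulerProduct.eulerProduct`;
  partial products `V_𝒜(N)/V_ℬ(N)·E_N(d)`, the tree's `tendsto_prodA_div_prodB`, and `E_N(d) = coprimeClassWeight d`
  for `N > d`);
* §G grouping the ideal sum by the norm (`∑_{N(J)=q}ρ₂(J)/N(J) = ρ₀(q)/q`, `μ(J) = μ(q)`), and the theorem.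

References: [cite: HeathBrownActa2001, §10 pp. 62–63]; [cite: HeathBrownMoroz2004, Lemma 4.1 (p. 20) and (3.1)];
[cite: MontgomeryVaughan2007, §6.2].
Tree: `…SigmaOneCoprimeCoeffs`, `HeathBrownCubicSigmaOne` (`summable_of_prod_tsum_le`, `tendsto_prodA_div_prodB`,
`idealMoebius_eq_moebius_absNorm`, `sigmaOneNormBound`), `RieszMeanInvDedekindZeta`
(`logRieszMean_LSeries_div_dedekindZeta_bound`), `HeathBrownCubicFLSequencesA` (`sum_normEq_rho₂_div_eq_densA`,
`densA_apply`), Mathlib `LSeries_convolution'`, `EulerProduct.eulerProduct`.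
-/

noncomputable section

open NumberField Finset Filter Topology
open scoped ArithmeticFunction.Moebius

namespace Summit.Parity.GeneralizedHardyLittlewood.Theorems.GoldbachHeathBrownDispersionHeathBrownMorozUniform

open Literature.NumberTheory
open Literature.NumberTheory.Sieve.CubicSieve Literature.NumberTheory.Sieve.CubicPrimes
open Literature.NumberTheory.LFunctions.CubeRootTwoField
open Literature.NumberTheory.LFunctions (idealNormCount)

/-! ### D. `∑_n |h_d(n)| n^{-3/4} ≤ M_d` -/

/-- The uniform bound for the finite Euler products of `F_d` (`d ≠ 0`):
`∏_{p<N} ∑_e F_d(p^e) ≤ (1 + T₀)^{ω(d)} exp((3 + T₀)∑_n n^{-3/2}) = M_d`. [folklore] -/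
theorem prod_tsum_sigmaOneFCop_le {d : ℕ} {a : ArithmeticFunction ℝ}
    (ha : ∀ n, a n = if Nat.Coprime d n then sigmaOneCoeff n else 0) (hd : d ≠ 0) (N : ℕ) :
    ∏ p ∈ Nat.primesBelow N, ∑' e : ℕ, |(a * normCountAF) (p ^ e)| * ((p ^ e : ℕ) : ℝ) ^ (-(3 / 4 : ℝ)) ≤
      (1 + sigmaOneTailConst) ^ d.primeFactors.card * sigmaOneNormBound := by
  have hZ : Summable fun n : ℕ => (n : ℝ) ^ (-(3 / 2 : ℝ)) :=
    Real.summable_nat_rpow.2 (by norm_num)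
  have hT := sigmaOneTailConst_nonneg
  set A : ℝ := 3 + sigmaOneTailConst with hA
  have hA0 : 0 ≤ A := by positivity
  set g : ℕ → ℝ := fun p => if p ∣ d then 1 + sigmaOneTailConst else 1 with hg
  -- each local factor is at most `g p · exp(A p^{-3/2})`
  have hloc : ∀ p ∈ Nat.primesBelow N,
      ∑' e : ℕ, |(a * normCountAF) (p ^ e)| * ((p ^ e : ℕ) : ℝ) ^ (-(3 / 4 : ℝ)) ≤
        g p * Real.exp (A * (p : ℝ) ^ (-(3 / 2 : ℝ))) := by
    intro p hp
    have hp' := (Nat.mem_primesBelow.1 hp).2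
    have hexp1 : 1 ≤ Real.exp (A * (p : ℝ) ^ (-(3 / 2 : ℝ))) :=
      Real.one_le_exp (mul_nonneg hA0 (Real.rpow_nonneg (Nat.cast_nonneg _) _))
    by_cases hpd : p ∣ d
    · simp only [hg, if_pos hpd]
      calc ∑' e : ℕ, |(a * normCountAF) (p ^ e)| * ((p ^ e : ℕ) : ℝ) ^ (-(3 / 4 : ℝ))
          ≤ sigmaOneTailConst := tsum_sigmaOneFCop_prime_pow_le ha hp'
        _ ≤ (1 + sigmaOneTailConst) * 1 := by linarith
        _ ≤ (1 + sigmaOneTailConst) * Real.exp (A * (p : ℝ) ^ (-(3 / 2 : ℝ))) :=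
            mul_le_mul_of_nonneg_left hexp1 (by linarith)
    · simp only [hg, if_neg hpd, one_mul]
      refine (tsum_sigmaOneFCop_prime_pow_le_of_not_dvd ha hp' hpd).trans ?_
      have := Real.add_one_le_exp (A * (p : ℝ) ^ (-(3 / 2 : ℝ)))
      linarith
  have hgprod : ∏ p ∈ Nat.primesBelow N, g p ≤ (1 + sigmaOneTailConst) ^ d.primeFactors.card := by
    rw [hg, ← prod_filter, prod_const]
    exact pow_le_pow_right₀ (by linarith) (card_le_card (primesBelow_filter_dvd_subset hd N))
  have hexpprod : ∏ p ∈ Nat.primesBelow N, Real.exp (A * (p : ℝ) ^ (-(3 / 2 : ℝ))) ≤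
      sigmaOneNormBound := by
    rw [sigmaOneNormBound, ← Real.exp_sum, Real.exp_le_exp, ← mul_sum]
    refine mul_le_mul_of_nonneg_left ?_ hA0
    exact hZ.sum_le_tsum _ fun n _ => Real.rpow_nonneg (Nat.cast_nonneg _) _
  calc ∏ p ∈ Nat.primesBelow N, ∑' e : ℕ, |(a * normCountAF) (p ^ e)| * ((p ^ e : ℕ) : ℝ) ^ (-(3 / 4 : ℝ))
      ≤ ∏ p ∈ Nat.primesBelow N, (g p * Real.exp (A * (p : ℝ) ^ (-(3 / 2 : ℝ)))) :=
        prod_le_prod (fun p _ => tsum_nonneg fun e => sigmaOneFCop_nonneg _ _) hloc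
    _ = (∏ p ∈ Nat.primesBelow N, g p) *
          ∏ p ∈ Nat.primesBelow N, Real.exp (A * (p : ℝ) ^ (-(3 / 2 : ℝ))) := prod_mul_distrib
    _ ≤ (1 + sigmaOneTailConst) ^ d.primeFactors.card * sigmaOneNormBound :=
        mul_le_mul hgprod hexpprod (prod_nonneg fun p _ => (Real.exp_pos _).le)
          (pow_nonneg (by linarith) _)

/-- **`∑_n |h_d(n)| n^{-3/4}` converges, with sum at most `M_d`** (`d ≠ 0`; "`f₀(s)` … converges absolutely …
for `Re(s) ≥ 3/4`"). [cite: HeathBrownActa2001, §10 p. 63] -/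
theorem summable_sigmaOneFCop {d : ℕ} {a : ArithmeticFunction ℝ}
    (ha : ∀ n, a n = if Nat.Coprime d n then sigmaOneCoeff n else 0) (hd : d ≠ 0) :
    (Summable fun n : ℕ => |(a * normCountAF) n| * ((n : ℕ) : ℝ) ^ (-(3 / 4 : ℝ))) ∧
      ∑' n : ℕ, |(a * normCountAF) n| * ((n : ℕ) : ℝ) ^ (-(3 / 4 : ℝ)) ≤
        (1 + sigmaOneTailConst) ^ d.primeFactors.card * sigmaOneNormBound :=
  summable_of_prod_tsum_le (sigmaOneFCop_nonneg a) (sigmaOneFCop_zero a) (sigmaOneFCop_one ha)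
    (fun h => sigmaOneFCop_mul_of_coprime ha h) (fun hp => summable_sigmaOneFCop_prime_pow ha hp)
    (prod_tsum_sigmaOneFCop_le ha hd)

/-! ### E. `f_d(s)ζ_K(s) = L(h_d, s)` and Perron's formula with the zero-free region -/

section Perron

open LSeries

/-- `∑ a_d(n) n^{-s}` converges absolutely for `Re s > 1` (`|a_d| ≤ c_K`). [folklore] -/
theorem LSeriesSummable_sigmaOneCoeffCop {d : ℕ} {a : ArithmeticFunction ℝ}
    (ha : ∀ n, a n = if Nat.Coprime d n then sigmaOneCoeff n else 0) {s : ℂ} (hs : 1 < s.re) :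
    LSeriesSummable (fun n => (a n : ℂ)) s := by
  refine Summable.of_norm_bounded
    (LFunctions.NumberField.LSeriesSummable_idealNormCount K hs).norm fun n => ?_
  refine norm_term_le s ?_
  rw [Complex.norm_real, Complex.norm_natCast, Real.norm_eq_abs]
  rcases eq_or_ne n 0 with rfl | hn
  · simp
  · have h := abs_sigmaOneCoeffCop_le ha n
    rwa [normCountAF_apply hn] at h

/-- **`f_d(s)ζ_K(s) = L(h_d, s)`** for `Re s > 1`, `h_d = a_d ⋆ c_K`. [cite: HeathBrownActa2001, §10 p. 63] -/
theorem LSeries_sigmaOneCoeffCop_mul_dedekindZeta {d : ℕ} {a : ArithmeticFunction ℝ}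
    (ha : ∀ n, a n = if Nat.Coprime d n then sigmaOneCoeff n else 0) {s : ℂ} (hs : 1 < s.re) :
    LSeries (fun n => (a n : ℂ)) s * NumberField.dedekindZeta K s =
      LSeries (fun n => ((a * normCountAF) n : ℂ)) s := by
  rw [LFunctions.dedekindZeta_eq_LSeries, ← LSeries_convolution' (LSeriesSummable_sigmaOneCoeffCop ha hs)
    (LFunctions.NumberField.LSeriesSummable_idealNormCount K hs)]
  refine LSeries_congr (fun {n} hn => ?_) s
  rw [LSeries.convolution_def, ArithmeticFunction.mul_apply]
  push_cast
  refine Finset.sum_congr rfl fun x hx => ?_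
  have hx2 : x.2 ≠ 0 := by
    have h := (Nat.mem_divisorsAntidiagonal.1 hx).1
    exact right_ne_zero_of_mul (h ▸ hn)
  rw [normCountAF_apply hx2, Complex.ofReal_natCast]

/-- `‖h_d(n) n^{-3/4}‖ = F_d(n)`. [folklore] -/
theorem norm_term_sigmaOneNumCop (a : ArithmeticFunction ℝ) (n : ℕ) :
    ‖term (fun n => ((a * normCountAF) n : ℂ)) ((3 / 4 : ℝ) : ℂ) n‖ =
      |(a * normCountAF) n| * ((n : ℕ) : ℝ) ^ (-(3 / 4 : ℝ)) := by
  rw [norm_term_eq]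
  rcases eq_or_ne n 0 with rfl | hn
  · rw [if_pos rfl, sigmaOneFCop_zero]
  · rw [if_neg hn, Complex.norm_real, Real.norm_eq_abs, Complex.ofReal_re,
      Real.rpow_neg (Nat.cast_nonneg _), div_eq_mul_inv]

/-- **Perron's formula and the zero-free region for `Σ₁^{(d)}`** (`d ≠ 0`):
`|∑_{n ≤ x} a_d(n)n^{-1}log(x/n) − L(h_d,1)/γ₀| ≤ C exp(−c√(log x))` for `x ≥ 1`, from the tree's
`logRieszMean_LSeries_div_dedekindZeta_bound` with `σ_h = 3/4`. [cite: HeathBrownActa2001, §10 pp. 62–63] -/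
theorem sigmaOneCop_logRieszMean_bound {d : ℕ} {a : ArithmeticFunction ℝ}
    (ha : ∀ n, a n = if Nat.Coprime d n then sigmaOneCoeff n else 0) (hd : d ≠ 0) :
    ∃ c : ℝ, 0 < c ∧ ∃ C : ℝ, 0 < C ∧ ∀ x : ℝ, 1 ≤ x →
      ‖(∑ n ∈ Finset.Icc 1 ⌊x⌋₊, (a n : ℂ) / n * (Real.log (x / n) : ℂ)) -
          LSeries (fun n => ((a * normCountAF) n : ℂ)) 1 / (NumberField.dedekindZeta_residue K : ℂ)‖ ≤
        C * Real.exp (-c * Real.sqrt (Real.log x)) := by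
  obtain ⟨c, hc, C, hC, h⟩ :=
    LFunctions.NumberField.logRieszMean_LSeries_div_dedekindZeta_bound K (σₕ := 3 / 4) (by norm_num)
  refine ⟨c, hc, C * ((1 + sigmaOneTailConst) ^ d.primeFactors.card * sigmaOneNormBound),
    mul_pos hC (sigmaOneNormBoundCop_pos d), fun x hx => ?_⟩
  have hh : LSeriesSummable (fun n => ((a * normCountAF) n : ℂ)) ((3 / 4 : ℝ) : ℂ) :=
    Summable.of_norm ((summable_sigmaOneFCop ha hd).1.congr fun n => (norm_term_sigmaOneNumCop a n).symm)
  have hB : ∑' n, ‖term (fun n => ((a * normCountAF) n : ℂ)) ((3 / 4 : ℝ) : ℂ) n‖ ≤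
      (1 + sigmaOneTailConst) ^ d.primeFactors.card * sigmaOneNormBound := by
    rw [tsum_congr (norm_term_sigmaOneNumCop a)]
    exact (summable_sigmaOneFCop ha hd).2
  exact h _ _ _ hh hB
    (fun σ hσ => LSeriesSummable_sigmaOneCoeffCop ha (by simpa using hσ))
    (fun s hs => LSeries_sigmaOneCoeffCop_mul_dedekindZeta ha hs) x hx

end Perron

/-! ### F. The residue: `L(h_d, 1) = ∑ h_d(n)/n = (σ₀γ₀π²/6)·coprimeClassWeight d` -/

/-- `L(h_d, 1)` is the real number `∑_n h_d(n)/n`. [folklore] -/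
theorem LSeries_sigmaOneNumCop_one (a : ArithmeticFunction ℝ) :
    LSeries (fun n => ((a * normCountAF) n : ℂ)) 1 =
      ((∑' n : ℕ, (a * normCountAF) n / ((n : ℕ) : ℝ) : ℝ) : ℂ) := by
  rw [LSeries, Complex.ofReal_tsum]
  refine tsum_congr fun n => ?_
  rcases eq_or_ne n 0 with rfl | hn
  · simp
  · rw [LSeries.term_of_ne_zero hn, Complex.cpow_one]
    push_cast
    rfl

/-- `∑ |h_d(n)|/n < ∞` (`1/n ≤ n^{-3/4}`; `d ≠ 0`). [folklore] -/
theorem summable_norm_sigmaOneQuotCop {d : ℕ} {a : ArithmeticFunction ℝ}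
    (ha : ∀ n, a n = if Nat.Coprime d n then sigmaOneCoeff n else 0) (hd : d ≠ 0) :
    Summable fun n : ℕ => ‖(a * normCountAF) n / ((n : ℕ) : ℝ)‖ := by
  refine Summable.of_nonneg_of_le (fun n => norm_nonneg _) (fun n => ?_) (summable_sigmaOneFCop ha hd).1
  rw [Real.norm_eq_abs, abs_div, Nat.abs_cast, div_eq_mul_inv]
  rcases eq_or_ne n 0 with rfl | hn
  · simp
  refine mul_le_mul_of_nonneg_left ?_ (abs_nonneg _)
  rw [← Real.rpow_neg_one]
  exact Real.rpow_le_rpow_of_exponent_le (by exact_mod_cast Nat.one_le_iff_ne_zero.2 hn)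
    (by norm_num)

/-- **The Euler product for `L(h_d, 1)`**: `∏_{p<N} ∑_e h_d(p^e)p^{-e} → ∑_n h_d(n)/n` (Mathlib's
`EulerProduct.eulerProduct`). [folklore] -/
theorem tendsto_prod_tsum_sigmaOneQuotCop {d : ℕ} {a : ArithmeticFunction ℝ}
    (ha : ∀ n, a n = if Nat.Coprime d n then sigmaOneCoeff n else 0) (hd : d ≠ 0) :
    Tendsto (fun N : ℕ => ∏ p ∈ Nat.primesBelow N, ∑' e : ℕ, (a * normCountAF) (p ^ e) / ((p ^ e : ℕ) : ℝ))
      atTop (𝓝 (∑' n : ℕ, (a * normCountAF) n / ((n : ℕ) : ℝ))) :=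
  EulerProduct.eulerProduct (f := fun n : ℕ => (a * normCountAF) n / ((n : ℕ) : ℝ)) (sigmaOneQuotCop_one ha)
    (fun hmn => sigmaOneQuotCop_mul_of_coprime ha hmn) (summable_norm_sigmaOneQuotCop ha hd)
    (sigmaOneQuotCop_zero a)

/-- **The residue**: `L(h_d, 1) = ∑_n h_d(n)/n = (σ₀γ₀π²/6)·coprimeClassWeight d` (`d ≠ 0`):
the partial Euler products are `V_𝒜(N)/V_ℬ(N)·E_N(d) → (σ₀γ₀π²/6)·coprimeClassWeight d`.
[cite: HeathBrownMoroz2004, Lemma 4.1 (p. 20)] [cite: HeathBrownActa2001, §10 p. 63] -/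
theorem tsum_sigmaOneQuotCop_eq {d : ℕ} {a : ArithmeticFunction ℝ}
    (ha : ∀ n, a n = if Nat.Coprime d n then sigmaOneCoeff n else 0) (hd : d ≠ 0) {σ₀ : ℝ}
    (hσ : Tendsto singularProductPartial atTop (𝓝 σ₀)) :
    ∑' n : ℕ, (a * normCountAF) n / ((n : ℕ) : ℝ) = σ₀ * gamma₀ * Real.pi ^ 2 / 6 * coprimeClassWeight d := by
  refine tendsto_nhds_unique (tendsto_prod_tsum_sigmaOneQuotCop ha hd) ?_
  simp only [prod_tsum_sigmaOneQuotCop_eq ha]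
  exact (tendsto_prodA_div_prodB hσ).mul (tendsto_prod_filter_dvd hd)

/-! ### G. `Σ₁^{(d)}` as a sum over the ideals of square-free norm coprime to `d`, and the theorem -/

open scoped Classical in
/-- **`Σ₁^{(d)}` grouped by the norm**: the sum of `μ(J)log(x/N(J))ρ₂(J)/N(J)` over the ideals `J` with
`N(J) ≤ x` square-free and coprime to `d` equals `∑_{n≤x} a_d(n)n^{-1}log(x/n)`
(`∑_{N(J)=n}ρ₂(J)/N(J) = ρ₀(n)/n` for square-free `n`, `μ(J) = μ(n)`). [cite: HeathBrownActa2001, §10 p. 62] -/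
theorem sigmaOneCop_sum_eq {d : ℕ} {a : ArithmeticFunction ℝ}
    (ha : ∀ n, a n = if Nat.Coprime d n then sigmaOneCoeff n else 0) (x : ℝ) :
    ∑ J ∈ (idealsLE ⌊x⌋₊).filter
        (fun J => Squarefree (Ideal.absNorm J) ∧ Nat.Coprime d (Ideal.absNorm J)),
        idealMoebius J * Real.log (x / Ideal.absNorm J) * (rho₂ J / Ideal.absNorm J) =
      ∑ n ∈ Finset.Icc 1 ⌊x⌋₊, a n / n * Real.log (x / n) := by
  set S := (idealsLE ⌊x⌋₊).filter
    (fun J => Squarefree (Ideal.absNorm J) ∧ Nat.Coprime d (Ideal.absNorm J)) with hS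
  have hmaps : ∀ J ∈ S, Ideal.absNorm J ∈ Finset.Icc 1 ⌊x⌋₊ := by
    intro J hJ
    rw [hS, mem_filter, mem_idealsLE] at hJ
    rw [Finset.mem_Icc]
    exact ⟨Nat.one_le_iff_ne_zero.2 (Squarefree.ne_zero hJ.2.1), hJ.1⟩
  rw [← sum_fiberwise_of_maps_to hmaps]
  refine sum_congr rfl fun n hn => ?_
  have hn1 : 1 ≤ n := (Finset.mem_Icc.1 hn).1
  have hn0 : n ≠ 0 := by omega
  by_cases hsq : Squarefree n ∧ Nat.Coprime d n
  · have hfib : S.filter (fun J => Ideal.absNorm J = n) = normEq n := by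
      ext J
      rw [mem_filter, hS, mem_filter, mem_idealsLE, mem_normEq]
      constructor
      · rintro ⟨-, h⟩; exact h
      · intro h; exact ⟨⟨h ▸ (Finset.mem_Icc.1 hn).2, h ▸ hsq⟩, h⟩
    rw [hfib]
    have hval : ∀ J ∈ normEq n,
        idealMoebius J * Real.log (x / Ideal.absNorm J) * (rho₂ J / Ideal.absNorm J) =
          (μ n : ℝ) * Real.log (x / n) * (rho₂ J / Ideal.absNorm J) := by
      intro J hJ
      rw [mem_normEq] at hJ
      rw [idealMoebius_eq_moebius_absNorm (hJ ▸ hsq.1), hJ]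
    rw [sum_congr rfl hval, ← mul_sum, sum_normEq_rho₂_div_eq_densA hsq.1, ha, if_pos hsq.2,
      sigmaOneCoeff_apply hn0, densA_apply hn0, prod_div_distrib, ← Nat.cast_prod,
      Nat.prod_primeFactors_of_squarefree hsq.1]
    ring
  · have hfib : S.filter (fun J => Ideal.absNorm J = n) = ∅ := by
      rw [Finset.filter_eq_empty_iff]
      intro J hJ hJn
      rw [hS, mem_filter] at hJ
      exact hsq (hJn ▸ hJ.2)
    have h0 : a n = 0 := by
      rw [ha]
      by_cases hc : Nat.Coprime d n
      · rw [if_pos hc]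
        exact sigmaOneCoeff_eq_zero_of_not_squarefree fun h => hsq ⟨h, hc⟩
      · rw [if_neg hc]
    rw [hfib, sum_empty, h0]
    simp

open scoped Classical in
/-- **Stub S3 `stub_sigmaOneCoprime` of line `parent-differencing` (crux `HeathBrownMorozUniform`,
stmt-Parity-19915) — the coprime-restricted singular sum `Σ₁^{(d)}`** (Heath-Brown–Moroz's `Σ₆`, p. 20,
"as in [3, p. 62]"): for `d ≥ 1` and `σ₀` the limit of the ordered partial products of Heath-Brown's singular
series there are `c, C > 0` with, for every `x ≥ 1`,
`|∑_{N(J) ≤ x, N(J) square-free, (d, N(J)) = 1} μ(J) log(x/N(J)) ρ₂(J)/N(J) − (π²/6)σ₀·coprimeClassWeight d| ≤ C e^{−c√(log x)}`.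
Literally the registered signature `ClassSigmaOneCoprime`; the case `d = 1` is
`CubicSieve.HeathBrown2001_sigmaOne_bound`.  Perron's formula for `f_d(s+1)x^s s^{-2}`,
`f_d(s) = ∑_{(q,d)=1}ρ₀(q)μ(q)q^{-s} = ζ_K(s)^{-1}L(h_d, s)`, the classical zero-free region for `ζ_K`, and the
residue `γ₀^{-1}L(h_d,1) = (π²/6)σ₀∏_{p∣d}(1 − ν_p/(p+1))^{-1}`.
[cite: HeathBrownMoroz2004, Lemma 4.1 (p. 20) and (3.1)] [cite: HeathBrownActa2001, §10 pp. 62–63] -/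
theorem classSigmaOneCoprime :
    ∀ d : ℕ, 0 < d → ∀ σ₀ : ℝ, Tendsto singularProductPartial atTop (𝓝 σ₀) →
      ∃ c : ℝ, 0 < c ∧ ∃ C : ℝ, 0 < C ∧ ∀ x : ℝ, 1 ≤ x →
        |(∑ J ∈ (idealsLE ⌊x⌋₊).filter
            (fun J => Squarefree (Ideal.absNorm J) ∧ Nat.Coprime d (Ideal.absNorm J)),
            idealMoebius J * Real.log (x / Ideal.absNorm J) * (rho₂ J / Ideal.absNorm J)) -
          Real.pi ^ 2 / 6 * σ₀ * coprimeClassWeight d| ≤ C * Real.exp (-c * Real.sqrt (Real.log x)) := by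
  intro d hd σ₀ hσ
  obtain ⟨a, ha⟩ := exists_sigmaOneCoeffCop d
  obtain ⟨c, hc, C, hC, h⟩ := sigmaOneCop_logRieszMean_bound ha hd.ne'
  refine ⟨c, hc, C, hC, fun x hx => ?_⟩
  have hx' := h x hx
  have hγ0 : gamma₀ ≠ 0 := gamma₀_pos.ne'
  have hγ : (NumberField.dedekindZeta_residue K : ℂ) = (gamma₀ : ℂ) := rfl
  have key : LSeries (fun n => ((a * normCountAF) n : ℂ)) 1 / (NumberField.dedekindZeta_residue K : ℂ) =
      ((Real.pi ^ 2 / 6 * σ₀ * coprimeClassWeight d : ℝ) : ℂ) := by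
    rw [LSeries_sigmaOneNumCop_one, tsum_sigmaOneQuotCop_eq ha hd.ne' hσ, hγ, ← Complex.ofReal_div]
    congr 1
    field_simp
  have hS : (∑ n ∈ Finset.Icc 1 ⌊x⌋₊, (a n : ℂ) / n * (Real.log (x / n) : ℂ)) =
      ((∑ n ∈ Finset.Icc 1 ⌊x⌋₊, a n / n * Real.log (x / n) : ℝ) : ℂ) := by
    push_cast
    rfl
  rw [key, hS, ← Complex.ofReal_sub, Complex.norm_real, Real.norm_eq_abs, ← sigmaOneCop_sum_eq ha] at hx'
  exact hx'

end Summit.Parity.GeneralizedHardyLittlewood.Theorems.GoldbachHeathBrownDispersionHeathBrownMorozUniform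

end
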